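import Literature.Probability.Percolation.TripodExchange
import HarnessLib

/-!
# The two-cluster exchange inequality (event form of van den Berg–Häggström–Kahn 2006, Thm. 1.5)

Topic `Literature/Probability/Percolation`.  Bond percolation with arbitrary edge probabilities on a
finite vertex type (`μ = prodBernoulli w`), two distinct vertices `s, t`, `D = {s ↮ t}`, and the open
edge clusters `C_s, C_t` (`openEdgeCluster`).  Call an event `A` of TYPE `(+)` if it is closed under
enlarging `C_s` and shrinking `C_t` (`C_s ω ⊆ C_s ω'`, `C_t ω' ⊆ C_t ω`, `ω ∈ A ⇒ ω' ∈ A`), and of TYPE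
`(−)` if it is closed under shrinking `C_s` and enlarging `C_t`.  BHK's Theorem 1.5 ("on `{s ↮ t}` we have
positive association of all the r.v.'s `1{e ∈ C_s}` and `1{e ∉ C_t}`", [VandenbergHaggstromKahn2005,
Thm. 1.5, p. 7, eq. (9)]; in the tree the DISCHARGED named fact
`BHK2006_twoClusterConditionalAssociation`) gives, for `A₁, A₂` of type `(+)` and `B₁, B₂` of type `(−)`,

  `μ(D ∩ A₁ ∩ B₁) · μ(D ∩ A₂ ∩ B₂) ≤ μ(D ∩ A₁ ∩ A₂) · μ(D ∩ B₁ ∩ B₂)`        (exchange)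

(`twoClusterExchange`): same-type events are positively and opposite-type events negatively
correlated given `D`, so `m² L₁ L₂ ≤ (a₁ b₁)(a₂ b₂) = (a₁ a₂)(b₁ b₂) ≤ m² R₁ R₂` with `m = μ(D)`,
`aᵢ = μ(D ∩ Aᵢ)`, `bᵢ = μ(D ∩ Bᵢ)`.  The generators `{s ↔ v}`, `{t ↮ v}` are of type `(+)` and
`{t ↔ v}`, `{s ↮ v}` of type `(−)` (`typePlus_openConn`, …), and both types are closed under `∩`.
The tripod exchange inequality (C⁺) of `TripodExchange.lean` is the instance `A₁ = {s↔o}`, `B₁ = {t↔z}`,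
`A₂ = {s↔z}`, `B₂ = {t↔o}`; with further "forbidden" vertices (`{s ↮ r}` of type `(−)`, `{t ↮ r}` of type
`(+)`) one gets the k-relay exchange rows used for the one-cut line of stmt-CriticalPhenomena-4575
(`twoClusterExchange_forbidden`).  No definition is introduced (the types are spelled out as hypotheses).

## References

* J. van den Berg, O. Häggström, J. Kahn, *Some conditional correlation inequalities for percolation and
  related processes*, Random Structures Algorithms 29 (2006) 417–435, Thm. 1.5 (p. 7). [VandenbergHaggstromKahn2005]
-/

noncomputable section

open MeasureTheory Set
open Literature.Probability.LatticeModels (prodBernoulli)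

namespace Literature.Probability.Percolation

variable {V : Type*}

namespace TwoClusterExchange

/-- **Functional four-product form of BHK Thm. 1.5.**  For `F₁, F₂ ≥ 0` increasing in `C_s` and
decreasing in `C_t`, and `G₁, G₂ ≥ 0` decreasing in `C_s` and increasing in `C_t`:
`(∫_D F₁G₁)(∫_D F₂G₂) ≤ (∫_D F₁F₂)(∫_D G₁G₂)`, `D = {s ↮ t}`.
[cite: VandenbergHaggstromKahn2005, Thm. 1.5 (p. 7) — corollary] -/
theorem fourProduct [Fintype V] (w : Sym2 V → unitInterval) {s t : V} (hst : s ≠ t)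
    (F₁ F₂ G₁ G₂ : Set (Sym2 V) → Set (Sym2 V) → ℝ)
    (hF₁m : ∀ E, Monotone fun C => F₁ C E) (hF₁a : ∀ C, Antitone fun E => F₁ C E)
    (hF₂m : ∀ E, Monotone fun C => F₂ C E) (hF₂a : ∀ C, Antitone fun E => F₂ C E)
    (hG₁a : ∀ E, Antitone fun C => G₁ C E) (hG₁m : ∀ C, Monotone fun E => G₁ C E)
    (hG₂a : ∀ E, Antitone fun C => G₂ C E) (hG₂m : ∀ C, Monotone fun E => G₂ C E)
    (hF₁ : ∀ C E, 0 ≤ F₁ C E) (hF₂ : ∀ C E, 0 ≤ F₂ C E) (hG₁ : ∀ C E, 0 ≤ G₁ C E)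
    (hG₂ : ∀ C E, 0 ≤ G₂ C E) :
    (∫ ω in {ω : BondConfig V | ¬ (openGraph ω).Reachable s t},
        F₁ (openEdgeCluster ω s) (openEdgeCluster ω t) * G₁ (openEdgeCluster ω s) (openEdgeCluster ω t)
          ∂(prodBernoulli w)) *
      (∫ ω in {ω : BondConfig V | ¬ (openGraph ω).Reachable s t},
        F₂ (openEdgeCluster ω s) (openEdgeCluster ω t) * G₂ (openEdgeCluster ω s) (openEdgeCluster ω t)
          ∂(prodBernoulli w)) ≤
    (∫ ω in {ω : BondConfig V | ¬ (openGraph ω).Reachable s t},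
        F₁ (openEdgeCluster ω s) (openEdgeCluster ω t) * F₂ (openEdgeCluster ω s) (openEdgeCluster ω t)
          ∂(prodBernoulli w)) *
      (∫ ω in {ω : BondConfig V | ¬ (openGraph ω).Reachable s t},
        G₁ (openEdgeCluster ω s) (openEdgeCluster ω t) * G₂ (openEdgeCluster ω s) (openEdgeCluster ω t)
          ∂(prodBernoulli w)) := by
  have hBHK := BHK2006_twoClusterConditionalAssociation_holds V w s t
  -- (a) F₁, F₂ same type
  have key_a := hBHK F₁ F₂ hF₁m hF₁a hF₂m hF₂a hst
  -- (b) -G₁, -G₂ same type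
  have key_b := hBHK (fun C E => -G₁ C E) (fun C E => -G₂ C E)
    (fun E _ _ h => neg_le_neg (hG₁a E h)) (fun C _ _ h => neg_le_neg (hG₁m C h))
    (fun E _ _ h => neg_le_neg (hG₂a E h)) (fun C _ _ h => neg_le_neg (hG₂m C h)) hst
  -- (c) F₁, -G₁ ; (d) F₂, -G₂
  have key_c := hBHK F₁ (fun C E => -G₁ C E) hF₁m hF₁a
    (fun E _ _ h => neg_le_neg (hG₁a E h)) (fun C _ _ h => neg_le_neg (hG₁m C h)) hst
  have key_d := hBHK F₂ (fun C E => -G₂ C E) hF₂m hF₂a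
    (fun E _ _ h => neg_le_neg (hG₂a E h)) (fun C _ _ h => neg_le_neg (hG₂m C h)) hst
  simp only [integral_neg, mul_neg, neg_mul, neg_neg, neg_le_neg_iff] at key_b key_c key_d
  set μ := prodBernoulli w with hμ
  set D := {ω : BondConfig V | ¬ (openGraph ω).Reachable s t} with hD
  have hDm : MeasurableSet D := MeasurableSet.of_discrete
  set m := μ.real D
  set a1 := ∫ ω in D, F₁ (openEdgeCluster ω s) (openEdgeCluster ω t) ∂μ
  set a2 := ∫ ω in D, F₂ (openEdgeCluster ω s) (openEdgeCluster ω t) ∂μ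
  set b1 := ∫ ω in D, G₁ (openEdgeCluster ω s) (openEdgeCluster ω t) ∂μ
  set b2 := ∫ ω in D, G₂ (openEdgeCluster ω s) (openEdgeCluster ω t) ∂μ
  set L1 := ∫ ω in D, F₁ (openEdgeCluster ω s) (openEdgeCluster ω t) *
    G₁ (openEdgeCluster ω s) (openEdgeCluster ω t) ∂μ
  set L2 := ∫ ω in D, F₂ (openEdgeCluster ω s) (openEdgeCluster ω t) *
    G₂ (openEdgeCluster ω s) (openEdgeCluster ω t) ∂μ
  set R1 := ∫ ω in D, F₁ (openEdgeCluster ω s) (openEdgeCluster ω t) *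
    F₂ (openEdgeCluster ω s) (openEdgeCluster ω t) ∂μ
  set R2 := ∫ ω in D, G₁ (openEdgeCluster ω s) (openEdgeCluster ω t) *
    G₂ (openEdgeCluster ω s) (openEdgeCluster ω t) ∂μ
  have hm0 : 0 ≤ m := measureReal_nonneg
  have ha1 : 0 ≤ a1 := setIntegral_nonneg hDm fun ω _ => hF₁ _ _
  have ha2 : 0 ≤ a2 := setIntegral_nonneg hDm fun ω _ => hF₂ _ _
  have hb1 : 0 ≤ b1 := setIntegral_nonneg hDm fun ω _ => hG₁ _ _
  have hb2 : 0 ≤ b2 := setIntegral_nonneg hDm fun ω _ => hG₂ _ _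
  have hL1 : 0 ≤ L1 := setIntegral_nonneg hDm fun ω _ => mul_nonneg (hF₁ _ _) (hG₁ _ _)
  have hL2 : 0 ≤ L2 := setIntegral_nonneg hDm fun ω _ => mul_nonneg (hF₂ _ _) (hG₂ _ _)
  have hR1 : 0 ≤ R1 := setIntegral_nonneg hDm fun ω _ => mul_nonneg (hF₁ _ _) (hF₂ _ _)
  have hR2 : 0 ≤ R2 := setIntegral_nonneg hDm fun ω _ => mul_nonneg (hG₁ _ _) (hG₂ _ _)
  rcases hm0.eq_or_lt with hm | hm
  · -- `μ(D) = 0`: every integral over `D` vanishes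
    have hD0 : μ D = 0 := (measureReal_eq_zero_iff (measure_ne_top μ D)).1 hm.symm
    have hL10 : L1 = 0 := setIntegral_measure_zero _ hD0
    rw [hL10, zero_mul]
    exact mul_nonneg hR1 hR2
  · have h1 : m * L1 * (m * L2) ≤ a1 * b1 * (a2 * b2) :=
      mul_le_mul key_c key_d (mul_nonneg hm0 hL2) (mul_nonneg ha1 hb1)
    have h2 : a1 * a2 * (b1 * b2) ≤ m * R1 * (m * R2) :=
      mul_le_mul key_a key_b (mul_nonneg hb1 hb2) (mul_nonneg hm0 hR1)
    have h3 : m * m * (L1 * L2) ≤ m * m * (R1 * R2) :=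
      calc m * m * (L1 * L2) = m * L1 * (m * L2) := by ring
        _ ≤ a1 * b1 * (a2 * b2) := h1
        _ = a1 * a2 * (b1 * b2) := by ring
        _ ≤ m * R1 * (m * R2) := h2
        _ = m * m * (R1 * R2) := by ring
    exact le_of_mul_le_mul_left h3 (mul_pos hm hm)

end TwoClusterExchange

open TwoClusterExchange in
/-- **The two-cluster exchange inequality (event form of BHK 2006, Thm. 1.5).**  Let `s ≠ t`,
`D = {s ↮ t}`; let `A₁, A₂` be events closed under (enlarging `C_s`, shrinking `C_t`) and `B₁, B₂`
events closed under (shrinking `C_s`, enlarging `C_t`).  Then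
`μ(D ∩ (A₁ ∩ B₁)) · μ(D ∩ (A₂ ∩ B₂)) ≤ μ(D ∩ (A₁ ∩ A₂)) · μ(D ∩ (B₁ ∩ B₂))`.
[cite: VandenbergHaggstromKahn2005, Thm. 1.5 (p. 7) — corollary, derived in this file] -/
theorem twoClusterExchange [Fintype V] (w : Sym2 V → unitInterval) {s t : V} (hst : s ≠ t)
    {A₁ A₂ B₁ B₂ : Set (BondConfig V)}
    (hA₁ : ∀ ⦃ω ω' : BondConfig V⦄, openEdgeCluster ω s ⊆ openEdgeCluster ω' s →
      openEdgeCluster ω' t ⊆ openEdgeCluster ω t → ω ∈ A₁ → ω' ∈ A₁)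
    (hA₂ : ∀ ⦃ω ω' : BondConfig V⦄, openEdgeCluster ω s ⊆ openEdgeCluster ω' s →
      openEdgeCluster ω' t ⊆ openEdgeCluster ω t → ω ∈ A₂ → ω' ∈ A₂)
    (hB₁ : ∀ ⦃ω ω' : BondConfig V⦄, openEdgeCluster ω' s ⊆ openEdgeCluster ω s →
      openEdgeCluster ω t ⊆ openEdgeCluster ω' t → ω ∈ B₁ → ω' ∈ B₁)
    (hB₂ : ∀ ⦃ω ω' : BondConfig V⦄, openEdgeCluster ω' s ⊆ openEdgeCluster ω s →
      openEdgeCluster ω t ⊆ openEdgeCluster ω' t → ω ∈ B₂ → ω' ∈ B₂) :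
    (prodBernoulli w).real ((openConn s t)ᶜ ∩ (A₁ ∩ B₁)) *
        (prodBernoulli w).real ((openConn s t)ᶜ ∩ (A₂ ∩ B₂)) ≤
      (prodBernoulli w).real ((openConn s t)ᶜ ∩ (A₁ ∩ A₂)) *
        (prodBernoulli w).real ((openConn s t)ᶜ ∩ (B₁ ∩ B₂)) := by
  classical
  -- witness functions: `F_A(C,E) = 1{∃ ω ∈ A, C_s ω ⊆ C, E ⊆ C_t ω}`, `G_B(C,E) = 1{∃ ω ∈ B, C ⊆ C_s ω, C_t ω ⊆ E}`
  let FA : Set (BondConfig V) → Set (Sym2 V) → Set (Sym2 V) → ℝ := fun A C E =>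
    if ∃ ω ∈ A, openEdgeCluster ω s ⊆ C ∧ E ⊆ openEdgeCluster ω t then 1 else 0
  let GB : Set (BondConfig V) → Set (Sym2 V) → Set (Sym2 V) → ℝ := fun B C E =>
    if ∃ ω ∈ B, C ⊆ openEdgeCluster ω s ∧ openEdgeCluster ω t ⊆ E then 1 else 0
  have FA_mono : ∀ A E, Monotone fun C => FA A C E := by
    intro A E C C' hCC'
    simp only [FA]
    by_cases h : ∃ ω ∈ A, openEdgeCluster ω s ⊆ C ∧ E ⊆ openEdgeCluster ω t
    · obtain ⟨ω, hω, h1, h2⟩ := h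
      rw [if_pos ⟨ω, hω, h1, h2⟩, if_pos ⟨ω, hω, h1.trans hCC', h2⟩]
    · rw [if_neg h]; split_ifs <;> norm_num
  have FA_anti : ∀ A C, Antitone fun E => FA A C E := by
    intro A C E E' hEE'
    simp only [FA]
    by_cases h : ∃ ω ∈ A, openEdgeCluster ω s ⊆ C ∧ E' ⊆ openEdgeCluster ω t
    · obtain ⟨ω, hω, h1, h2⟩ := h
      rw [if_pos ⟨ω, hω, h1, h2⟩, if_pos ⟨ω, hω, h1, hEE'.trans h2⟩]
    · rw [if_neg h]; split_ifs <;> norm_num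
  have GB_anti : ∀ B E, Antitone fun C => GB B C E := by
    intro B E C C' hCC'
    simp only [GB]
    by_cases h : ∃ ω ∈ B, C' ⊆ openEdgeCluster ω s ∧ openEdgeCluster ω t ⊆ E
    · obtain ⟨ω, hω, h1, h2⟩ := h
      rw [if_pos ⟨ω, hω, h1, h2⟩, if_pos ⟨ω, hω, hCC'.trans h1, h2⟩]
    · rw [if_neg h]; split_ifs <;> norm_num
  have GB_mono : ∀ B C, Monotone fun E => GB B C E := by
    intro B C E E' hEE'
    simp only [GB]
    by_cases h : ∃ ω ∈ B, C ⊆ openEdgeCluster ω s ∧ openEdgeCluster ω t ⊆ E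
    · obtain ⟨ω, hω, h1, h2⟩ := h
      rw [if_pos ⟨ω, hω, h1, h2⟩, if_pos ⟨ω, hω, h1, h2.trans hEE'⟩]
    · rw [if_neg h]; split_ifs <;> norm_num
  have FA_nn : ∀ A C E, 0 ≤ FA A C E := by
    intro A C E; simp only [FA]; split_ifs <;> norm_num
  have GB_nn : ∀ B C E, 0 ≤ GB B C E := by
    intro B C E; simp only [GB]; split_ifs <;> norm_num
  -- evaluation on a configuration
  have FA_eval : ∀ {A : Set (BondConfig V)},
      (∀ ⦃ω ω' : BondConfig V⦄, openEdgeCluster ω s ⊆ openEdgeCluster ω' s →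
        openEdgeCluster ω' t ⊆ openEdgeCluster ω t → ω ∈ A → ω' ∈ A) →
      ∀ ω', FA A (openEdgeCluster ω' s) (openEdgeCluster ω' t) = A.indicator 1 ω' := by
    intro A hA ω'
    simp only [FA]
    by_cases hω' : ω' ∈ A
    · rw [if_pos ⟨ω', hω', subset_rfl, subset_rfl⟩, indicator_of_mem hω', Pi.one_apply]
    · rw [indicator_of_notMem hω', if_neg]
      rintro ⟨ω, hω, h1, h2⟩
      exact hω' (hA h1 h2 hω)
  have GB_eval : ∀ {B : Set (BondConfig V)},
      (∀ ⦃ω ω' : BondConfig V⦄, openEdgeCluster ω' s ⊆ openEdgeCluster ω s →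
        openEdgeCluster ω t ⊆ openEdgeCluster ω' t → ω ∈ B → ω' ∈ B) →
      ∀ ω', GB B (openEdgeCluster ω' s) (openEdgeCluster ω' t) = B.indicator 1 ω' := by
    intro B hB ω'
    simp only [GB]
    by_cases hω' : ω' ∈ B
    · rw [if_pos ⟨ω', hω', subset_rfl, subset_rfl⟩, indicator_of_mem hω', Pi.one_apply]
    · rw [indicator_of_notMem hω', if_neg]
      rintro ⟨ω, hω, h1, h2⟩
      exact hω' (hB h1 h2 hω)
  have key := fourProduct w hst (FA A₁) (FA A₂) (GB B₁) (GB B₂)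
    (FA_mono A₁) (FA_anti A₁) (FA_mono A₂) (FA_anti A₂)
    (GB_anti B₁) (GB_mono B₁) (GB_anti B₂) (GB_mono B₂)
    (FA_nn A₁) (FA_nn A₂) (GB_nn B₁) (GB_nn B₂)
  have hDc : {ω : BondConfig V | ¬ (openGraph ω).Reachable s t} = (openConn s t)ᶜ := rfl
  simp only [hDc, FA_eval hA₁, FA_eval hA₂, GB_eval hB₁, GB_eval hB₂,
    TripodExchange.setIntegral_indicator_mul_indicator_eq] at key
  exact key

/-! ### Generators of the two types -/

/-- `{s ↔ v}` is of type `(+)` (closed under enlarging `C_s`, shrinking `C_t`). [folklore] -/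
theorem typePlus_openConn (s t v : V) ⦃ω ω' : BondConfig V⦄
    (hs : openEdgeCluster ω s ⊆ openEdgeCluster ω' s) (_ht : openEdgeCluster ω' t ⊆ openEdgeCluster ω t)
    (h : ω ∈ (openConn s v : Set (BondConfig V))) : ω' ∈ (openConn s v : Set (BondConfig V)) := by
  change (openGraph ω').Reachable s v
  rw [reachable_iff_exists_mem_openEdgeCluster]
  rcases (reachable_iff_exists_mem_openEdgeCluster ω s v).1 h with h1 | ⟨e, he, hve⟩
  · exact Or.inl h1
  · exact Or.inr ⟨e, hs he, hve⟩

/-- `{t ↮ v}` is of type `(+)`. [folklore] -/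
theorem typePlus_not_openConn (s t v : V) ⦃ω ω' : BondConfig V⦄
    (_hs : openEdgeCluster ω s ⊆ openEdgeCluster ω' s) (ht : openEdgeCluster ω' t ⊆ openEdgeCluster ω t)
    (h : ω ∈ (openConn t v : Set (BondConfig V))ᶜ) : ω' ∈ (openConn t v : Set (BondConfig V))ᶜ := by
  intro h'
  apply h
  change (openGraph ω).Reachable t v
  rw [reachable_iff_exists_mem_openEdgeCluster]
  rcases (reachable_iff_exists_mem_openEdgeCluster ω' t v).1 h' with h1 | ⟨e, he, hve⟩
  · exact Or.inl h1
  · exact Or.inr ⟨e, ht he, hve⟩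

/-- `{t ↔ v}` is of type `(−)` (closed under shrinking `C_s`, enlarging `C_t`). [folklore] -/
theorem typeMinus_openConn (s t v : V) ⦃ω ω' : BondConfig V⦄
    (_hs : openEdgeCluster ω' s ⊆ openEdgeCluster ω s) (ht : openEdgeCluster ω t ⊆ openEdgeCluster ω' t)
    (h : ω ∈ (openConn t v : Set (BondConfig V))) : ω' ∈ (openConn t v : Set (BondConfig V)) := by
  change (openGraph ω').Reachable t v
  rw [reachable_iff_exists_mem_openEdgeCluster]
  rcases (reachable_iff_exists_mem_openEdgeCluster ω t v).1 h with h1 | ⟨e, he, hve⟩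
  · exact Or.inl h1
  · exact Or.inr ⟨e, ht he, hve⟩

/-- `{s ↮ v}` is of type `(−)`. [folklore] -/
theorem typeMinus_not_openConn (s t v : V) ⦃ω ω' : BondConfig V⦄
    (hs : openEdgeCluster ω' s ⊆ openEdgeCluster ω s) (_ht : openEdgeCluster ω t ⊆ openEdgeCluster ω' t)
    (h : ω ∈ (openConn s v : Set (BondConfig V))ᶜ) : ω' ∈ (openConn s v : Set (BondConfig V))ᶜ := by
  intro h'
  apply h
  change (openGraph ω).Reachable s v
  rw [reachable_iff_exists_mem_openEdgeCluster]
  rcases (reachable_iff_exists_mem_openEdgeCluster ω' s v).1 h' with h1 | ⟨e, he, hve⟩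
  · exact Or.inl h1
  · exact Or.inr ⟨e, hs he, hve⟩

/-- **Tripod exchange with forbidden sets** (the `k`-relay exchange row).  For `s ≠ t`, vertices
`o, z` and finite sets `R, R'` of vertices: with `D = {s ↮ t}`,
`μ(D ∩ {s↔o} ∩ {t↔z} ∩ {s↮R}) · μ(D ∩ {t↔o} ∩ {s↔z} ∩ {t↮R'}) ≤ μ(D ∩ {s↔o} ∩ {s↔z} ∩ {t↮R'}) · μ(D ∩ {t↔o} ∩ {t↔z} ∩ {s↮R})`,
where `{s ↮ R} = ⋂_{r ∈ R} {s ↮ r}`.  For `R = R' = ∅` this is the tripod exchange inequality (C⁺).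
[cite: VandenbergHaggstromKahn2005, Thm. 1.5 (p. 7) — corollary, derived in this file] -/
theorem twoClusterExchange_forbidden [Fintype V] (w : Sym2 V → unitInterval) {s t : V} (hst : s ≠ t)
    (o z : V) (R R' : Finset V) :
    (prodBernoulli w).real ((openConn s t)ᶜ ∩
        ((openConn s o ∩ ⋂ r ∈ R', (openConn t r)ᶜ) ∩ (openConn t z ∩ ⋂ r ∈ R, (openConn s r)ᶜ))) *
      (prodBernoulli w).real ((openConn s t)ᶜ ∩
        ((openConn s z ∩ ⋂ r ∈ R', (openConn t r)ᶜ) ∩ (openConn t o ∩ ⋂ r ∈ R, (openConn s r)ᶜ))) ≤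
    (prodBernoulli w).real ((openConn s t)ᶜ ∩
        ((openConn s o ∩ ⋂ r ∈ R', (openConn t r)ᶜ) ∩ (openConn s z ∩ ⋂ r ∈ R', (openConn t r)ᶜ))) *
      (prodBernoulli w).real ((openConn s t)ᶜ ∩
        ((openConn t z ∩ ⋂ r ∈ R, (openConn s r)ᶜ) ∩ (openConn t o ∩ ⋂ r ∈ R, (openConn s r)ᶜ))) := by
  refine twoClusterExchange w hst ?_ ?_ ?_ ?_
  · intro ω ω' h1 h2 hω
    exact ⟨typePlus_openConn s t o h1 h2 hω.1,
      mem_iInter₂.2 fun r hr => typePlus_not_openConn s t r h1 h2 (mem_iInter₂.1 hω.2 r hr)⟩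
  · intro ω ω' h1 h2 hω
    exact ⟨typePlus_openConn s t z h1 h2 hω.1,
      mem_iInter₂.2 fun r hr => typePlus_not_openConn s t r h1 h2 (mem_iInter₂.1 hω.2 r hr)⟩
  · intro ω ω' h1 h2 hω
    exact ⟨typeMinus_openConn s t z h1 h2 hω.1,
      mem_iInter₂.2 fun r hr => typeMinus_not_openConn s t r h1 h2 (mem_iInter₂.1 hω.2 r hr)⟩
  · intro ω ω' h1 h2 hω
    exact ⟨typeMinus_openConn s t o h1 h2 hω.1,
      mem_iInter₂.2 fun r hr => typeMinus_not_openConn s t r h1 h2 (mem_iInter₂.1 hω.2 r hr)⟩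

end Literature.Probability.Percolation

end
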